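import Literature.MathematicalPhysics.QuantumLattice.SchwingerOSAxioms
import Literature.MathematicalPhysics.QuantumLattice.SchwingerOSPositivity
import HarnessLib

/-!
# Schwartz norms of tensor products `⊗ⱼ fⱼ`

Support file (everything proved, no definitions): bounds for the Schwartz norms
`|·|_M = max_{k,l ≤ M} p_{k,l}` (`QuantumLattice.schwartzNorm`) of the tensor products
`SchwartzMap.tensorFin n f = ⊗ⱼ fⱼ` of one-variable Schwartz functions on a product `Eⁿ`:

  `|⊗ⱼ fⱼ|_M ≤ (2^{M+1})ⁿ ∏ⱼ |fⱼ|_M`   (`schwartzNorm_tensorFin_le`),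

by the recursion `⊗_{j≤n} fⱼ = (⊗_{j<n} fⱼ) ⊗ fₙ` (`SchwartzMap.mulComp`), the tree's
`SchwartzMap.seminorm_mulComp_le`, and `∑ᵢ C(l,i) = 2ˡ`. `norm_restrictCLM_le_one` generalises
`OSVectorNormGrowth.norm_restrictCLM_le` (stated there for `EuclideanSpace ℝ (Fin d)`) to any `E`, and
`mulCompBound_le_schwartzNorm` abstracts the body of `OSVectorNormGrowth.schwartzNorm_appendTensor_le`;
that file can be refactored onto these. Needed for the explicit weights
(products of one-variable Schwartz functions of the point times) of the regularised clusters in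
the Osterwalder–Schrader estimates (Comm. Math. Phys. 42 (1975), Ch. VI.1).
-/

noncomputable section

open scoped SchwartzMap

namespace Literature.MathematicalPhysics.QuantumFieldTheory

open Literature.MathematicalPhysics.QuantumLattice (schwartzNorm)

variable {E : Type*} [NormedAddCommGroup E] [NormedSpace ℝ E]

/-- Coordinate restrictions `x ↦ x ∘ ι` have operator norm `≤ 1`. [folklore] -/
theorem norm_restrictCLM_le_one {α β : Type*} [Fintype α] [Fintype β] (ι : α → β) :
    ‖SchwartzMap.restrictCLM (E := E) ι‖ ≤ 1 := by
  refine ContinuousLinearMap.opNorm_le_bound _ zero_le_one fun x => ?_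
  rw [one_mul, SchwartzMap.restrictCLM_apply]
  exact (pi_norm_le_iff_of_nonneg (norm_nonneg _)).2 fun a => norm_le_pi_norm x (ι a)

/-- Coordinate projections have operator norm `≤ 1`. [folklore] -/
theorem norm_proj_le_one {n : ℕ} (i : Fin n) : ‖(ContinuousLinearMap.proj (R := ℝ) (φ := fun _ : Fin n => E) i)‖ ≤ 1 :=
  ContinuousLinearMap.opNorm_le_bound _ zero_le_one fun x => by rw [one_mul]; exact norm_le_pi_norm x i

/-- **A `mulCompBound` with projections of norm `≤ 1` and constant `1` is at most
`2^{l+1} |f|_M |g|_M`** for `k, l ≤ M`. [folklore] -/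
theorem mulCompBound_le_schwartzNorm {D E₁ E₂ : Type*} [NormedAddCommGroup D] [NormedSpace ℝ D]
    [NormedAddCommGroup E₁] [NormedSpace ℝ E₁] [NormedAddCommGroup E₂] [NormedSpace ℝ E₂]
    (π₁ : D →L[ℝ] E₁) (π₂ : D →L[ℝ] E₂) (h₁ : ‖π₁‖ ≤ 1) (h₂ : ‖π₂‖ ≤ 1)
    (f : 𝓢(E₁, ℂ)) (g : 𝓢(E₂, ℂ)) {k l M : ℕ} (hk : k ≤ M) (hl : l ≤ M) :
    SchwartzMap.mulCompBound π₁ π₂ 1 k l f g ≤ 2 ^ (l + 1) * schwartzNorm M f * schwartzNorm M g := by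
  have hF0 := QuantumLattice.schwartzNorm_nonneg M f
  have hG0 := QuantumLattice.schwartzNorm_nonneg M g
  unfold SchwartzMap.mulCompBound
  rw [abs_one, one_pow, one_mul]
  have hterm : ∀ i ∈ Finset.range (l + 1), (l.choose i : ℝ) * (‖π₁‖ ^ i * ‖π₂‖ ^ (l - i)) *
      (SchwartzMap.seminorm ℝ k i f * SchwartzMap.seminorm ℝ 0 (l - i) g +
        SchwartzMap.seminorm ℝ 0 i f * SchwartzMap.seminorm ℝ k (l - i) g) ≤
      (l.choose i : ℝ) * (2 * (schwartzNorm M f * schwartzNorm M g)) := by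
    intro i hi
    rw [Finset.mem_range] at hi
    have hπ : ‖π₁‖ ^ i * ‖π₂‖ ^ (l - i) ≤ 1 :=
      mul_le_one₀ (pow_le_one₀ (norm_nonneg _) h₁) (by positivity) (pow_le_one₀ (norm_nonneg _) h₂)
    -- real and complex Schwartz seminorms agree definitionally (`seminorm_real_eq` in `OSVectorNormGrowth`)
    have e1 : SchwartzMap.seminorm ℝ k i f ≤ schwartzNorm M f :=
      QuantumLattice.seminorm_le_schwartzNorm (m := M) hk (by omega) f
    have e2 : SchwartzMap.seminorm ℝ 0 (l - i) g ≤ schwartzNorm M g :=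
      QuantumLattice.seminorm_le_schwartzNorm (m := M) (Nat.zero_le _) (by omega) g
    have e3 : SchwartzMap.seminorm ℝ 0 i f ≤ schwartzNorm M f :=
      QuantumLattice.seminorm_le_schwartzNorm (m := M) (Nat.zero_le _) (by omega) f
    have e4 : SchwartzMap.seminorm ℝ k (l - i) g ≤ schwartzNorm M g :=
      QuantumLattice.seminorm_le_schwartzNorm (m := M) hk (by omega) g
    have hsum : SchwartzMap.seminorm ℝ k i f * SchwartzMap.seminorm ℝ 0 (l - i) g +
        SchwartzMap.seminorm ℝ 0 i f * SchwartzMap.seminorm ℝ k (l - i) g ≤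
        2 * (schwartzNorm M f * schwartzNorm M g) := by
      have := mul_le_mul e1 e2 (apply_nonneg _ _) hF0
      have := mul_le_mul e3 e4 (apply_nonneg _ _) hF0
      linarith
    calc (l.choose i : ℝ) * (‖π₁‖ ^ i * ‖π₂‖ ^ (l - i)) *
          (SchwartzMap.seminorm ℝ k i f * SchwartzMap.seminorm ℝ 0 (l - i) g +
            SchwartzMap.seminorm ℝ 0 i f * SchwartzMap.seminorm ℝ k (l - i) g)
        ≤ (l.choose i : ℝ) * 1 * (2 * (schwartzNorm M f * schwartzNorm M g)) := by gcongr
      _ = _ := by ring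
  refine (Finset.sum_le_sum hterm).trans ?_
  rw [← Finset.sum_mul]
  have hchoose : ∑ i ∈ Finset.range (l + 1), (l.choose i : ℝ) = 2 ^ l := by exact_mod_cast Nat.sum_range_choose l
  rw [hchoose, pow_succ]
  exact le_of_eq (by ring)

/-- The norm control of the recursion `x ↦ (x ∘ castSucc, x last)`. [folklore] -/
theorem norm_le_max_castSucc_last {n : ℕ} (x : Fin (n + 1) → E) :
    ‖x‖ ≤ 1 * max ‖SchwartzMap.restrictCLM (E := E) Fin.castSucc x‖
      ‖(ContinuousLinearMap.proj (R := ℝ) (φ := fun _ : Fin (n + 1) => E) (Fin.last n)) x‖ := by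
  rw [one_mul, pi_norm_le_iff_of_nonneg (by positivity)]
  intro i
  induction i using Fin.lastCases with
  | last => exact le_max_right _ _
  | cast j => exact (norm_le_pi_norm (x ∘ Fin.castSucc) j).trans (le_max_left _ _)

/-- The recursion of `tensorFin` as an equation. [folklore] -/
theorem tensorFin_succ_eq {n : ℕ} (f : Fin (n + 1) → 𝓢(E, ℂ)) :
    SchwartzMap.tensorFin (n + 1) f =
      SchwartzMap.mulComp (SchwartzMap.tensorFin n fun i => f i.castSucc) (f (Fin.last n))
        (SchwartzMap.restrictCLM Fin.castSucc) (ContinuousLinearMap.proj (Fin.last n))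
        ⟨1, norm_le_max_castSucc_last⟩ := rfl

/-- Seminorms of the recursion step through `mulCompBound`. [folklore] -/
theorem seminorm_tensorFin_succ_le_mulCompBound {n : ℕ} (f : Fin (n + 1) → 𝓢(E, ℂ)) (k l : ℕ) :
    SchwartzMap.seminorm ℂ k l (SchwartzMap.tensorFin (n + 1) f) ≤
      SchwartzMap.mulCompBound (SchwartzMap.restrictCLM (E := E) Fin.castSucc)
        (ContinuousLinearMap.proj (R := ℝ) (φ := fun _ : Fin (n + 1) => E) (Fin.last n)) 1 k l
        (SchwartzMap.tensorFin n fun i => f i.castSucc) (f (Fin.last n)) := by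
  rw [tensorFin_succ_eq f]
  exact SchwartzMap.seminorm_mulComp_le _ _ _ _ _ norm_le_max_castSucc_last k l

/-- **Seminorms of the recursion step**: `p_{k,l}(tensorFin (n+1) f) ≤ 2^{l+1} |tensorFin n (f ∘ castSucc)|_M |f last|_M`
for `k, l ≤ M`. [folklore] -/
theorem seminorm_tensorFin_succ_le {n : ℕ} (f : Fin (n + 1) → 𝓢(E, ℂ)) {k l M : ℕ} (hk : k ≤ M) (hl : l ≤ M) :
    SchwartzMap.seminorm ℂ k l (SchwartzMap.tensorFin (n + 1) f) ≤
      2 ^ (l + 1) * schwartzNorm M (SchwartzMap.tensorFin n fun i => f i.castSucc) * schwartzNorm M (f (Fin.last n)) := by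
  have h1 := seminorm_tensorFin_succ_le_mulCompBound f k l
  have h2 := mulCompBound_le_schwartzNorm (D := Fin (n + 1) → E) (E₁ := Fin n → E) (E₂ := E)
    (SchwartzMap.restrictCLM (E := E) Fin.castSucc)
    (ContinuousLinearMap.proj (R := ℝ) (φ := fun _ : Fin (n + 1) => E) (Fin.last n))
    (norm_restrictCLM_le_one _) (norm_proj_le_one _) (SchwartzMap.tensorFin n fun i => f i.castSucc) (f (Fin.last n)) hk hl
  exact h1.trans h2

/-- **Schwartz norms of the recursion step**:
`|tensorFin (n+1) f|_M ≤ 2^{M+1} |tensorFin n (f ∘ castSucc)|_M |f last|_M`. [folklore] -/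
theorem schwartzNorm_tensorFin_succ_le {n : ℕ} (f : Fin (n + 1) → 𝓢(E, ℂ)) (M : ℕ) :
    schwartzNorm M (SchwartzMap.tensorFin (n + 1) f) ≤
      2 ^ (M + 1) * schwartzNorm M (SchwartzMap.tensorFin n fun i => f i.castSucc) * schwartzNorm M (f (Fin.last n)) := by
  have hF0 := QuantumLattice.schwartzNorm_nonneg M (SchwartzMap.tensorFin n fun i => f i.castSucc)
  have hG0 := QuantumLattice.schwartzNorm_nonneg M (f (Fin.last n))
  unfold QuantumLattice.schwartzNorm
  refine Seminorm.finset_sup_apply_le (by positivity) fun q hq => ?_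
  rw [Finset.mem_Iic] at hq
  rw [SchwartzMap.schwartzSeminormFamily_apply]
  refine (seminorm_tensorFin_succ_le f hq.1 hq.2).trans ?_
  have hq2 : q.2 ≤ M := hq.2
  have h2 : (2 : ℝ) ^ (q.2 + 1) ≤ 2 ^ (M + 1) := pow_le_pow_right₀ (by norm_num) (by omega)
  exact mul_le_mul (mul_le_mul_of_nonneg_right h2 hF0) le_rfl hG0 (by positivity)

/-- The empty tensor has Schwartz norms `≤ 1`. [folklore] -/
theorem schwartzNorm_tensorFin_zero_le (f : Fin 0 → 𝓢(E, ℂ)) (M : ℕ) :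
    schwartzNorm M (SchwartzMap.tensorFin 0 f) ≤ 1 := by
  change ((Finset.Iic (M, M)).sup (schwartzSeminormFamily ℂ _ ℂ)) (SchwartzMap.tensorFin 0 f) ≤ _
  refine Seminorm.finset_sup_apply_le zero_le_one fun q _ => ?_
  rw [SchwartzMap.schwartzSeminormFamily_apply]
  refine SchwartzMap.seminorm_le_bound ℂ q.1 q.2 _ zero_le_one fun x => ?_
  have hx : ‖x‖ = 0 := by rw [Subsingleton.elim x 0, norm_zero]
  have hfun : (SchwartzMap.tensorFin 0 f : (Fin 0 → E) → ℂ) = fun _ => (1 : ℂ) := by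
    funext y; simp [SchwartzMap.tensorFin_apply]
  rw [hfun]
  rcases Nat.eq_zero_or_pos q.2 with h0 | hpos
  · rw [h0, norm_iteratedFDeriv_zero, norm_one, mul_one]
    rcases Nat.eq_zero_or_pos q.1 with h1 | h1
    · rw [h1, pow_zero]
    · rw [hx, zero_pow h1.ne']; exact zero_le_one
  · rw [iteratedFDeriv_const_of_ne hpos.ne']
    simp

/-- **Schwartz norms of tensor products**: `|⊗ⱼ fⱼ|_M ≤ (2^{M+1})ⁿ ∏ⱼ |fⱼ|_M`. [folklore] -/
theorem schwartzNorm_tensorFin_le {n : ℕ} (f : Fin n → 𝓢(E, ℂ)) (M : ℕ) :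
    schwartzNorm M (SchwartzMap.tensorFin n f) ≤ (2 ^ (M + 1)) ^ n * ∏ j, schwartzNorm M (f j) := by
  induction n with
  | zero => simpa using schwartzNorm_tensorFin_zero_le f M
  | succ n ih =>
      refine (schwartzNorm_tensorFin_succ_le f M).trans ?_
      have h := ih fun i => f i.castSucc
      have hlast := QuantumLattice.schwartzNorm_nonneg M (f (Fin.last n))
      rw [Fin.prod_univ_castSucc, pow_succ]
      calc 2 ^ (M + 1) * schwartzNorm M (SchwartzMap.tensorFin n fun i => f i.castSucc) * schwartzNorm M (f (Fin.last n))
          ≤ 2 ^ (M + 1) * ((2 ^ (M + 1)) ^ n * ∏ j : Fin n, schwartzNorm M (f j.castSucc)) * schwartzNorm M (f (Fin.last n)) := by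
            gcongr
        _ = (2 ^ (M + 1)) ^ n * 2 ^ (M + 1) * ((∏ j : Fin n, schwartzNorm M (f j.castSucc)) * schwartzNorm M (f (Fin.last n))) := by
            ring

end Literature.MathematicalPhysics.QuantumFieldTheory
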